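import Summits.NavierStokesRegularity.NavierStokesRegularity.Theorems.FilamentSkeletonRssCoreLinearInvertibilityArnoldModeOne1DDeflation

/-!
# Stub `stub_arnoldModeOne1D` (crux `CoreLinearInvertibility`, stmt-NavierStokesRegularity-17973,
# route `FilamentSkeletonRss`, line `Sketch`): the `k = ±1` constrained Arnold coercivity at the Gaussian

For the radial coefficient `a` (continuous on `[0,∞)`, Gaussian class) of the `k = ±1` angular part of
an odd vorticity, with the first-moment constraint `∫₀^∞ r² a dr = 0`,

  `γ ∫ Φ⁻¹ a² r ≤ ∫ Φ⁻¹ a² r − ∫ (B₁a) a r`,  `(B₁a)(r) = ½∫₀^∞ min(r/s, s/r) a(s) s ds`, `γ = 1/9`,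

(`Φ = kerWeight`; Gallay–Šverák, arXiv:2110.13739, §2, the case `k = 1` of Thm. 2.5 / Rem. 2.7 at the
Gaussian). PROOF (elementary, no spectral theory): write `a = g + (α/2) a⋆` with the neutral mode
`a⋆ = r e^{−r²/4}` (`B₁a⋆ = Φ⁻¹a⋆`, `‖a⋆‖² = 4` in `L²(Φ⁻¹ r dr)`) and `g ⊥ a⋆`; then
`∫Φ⁻¹a²r = Q(g) + α²` and, by the energy identity (part B), the cross identity and the energy of `a⋆`
(part C), `∫(B₁a) a r = P(g) + α²`; the deflation bound (part D, a trace argument: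
`λ₂ ≤ tr B̃₁ − 1 ≤ 2/3`) gives `P(g) ≤ (2/3)Q(g)`; the constraint and Cauchy–Schwarz give
`16α² = (∫r²g)² ≤ (∫r³Φ) Q(g) ≤ 32 Q(g)`; hence `Q(a) − P(a) ≥ Q(g)/3 ≥ Q(a)/9`.
-/

set_option linter.dupNamespace false

noncomputable section

namespace Summit.NavierStokesRegularity.NavierStokesRegularity.Theorems

open Set Function Filter MeasureTheory Topology
open Literature.Analysis.FluidPDE

/-- **The `k = 1` constrained coercivity for continuous Gaussian-class `f` with `∫ r² f = 0`**:
`(1/9) ∫Φ⁻¹f²r ≤ ∫Φ⁻¹f²r − ∫(B₁f) f r`. [cite: GallaySverak2021, Thm. 2.5 proof] -/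
theorem am1_coercive_continuous {f : ℝ → ℝ} (hf : Continuous f) {C : ℝ} {N : ℕ}
    (hb : ∀ r, 0 ≤ r → |f r| ≤ C * (1 + r) ^ N * Real.exp (-(r ^ 2 / 4)))
    (hm : ∫ r in Ioi (0 : ℝ), r ^ 2 * f r = 0) :
    (1 / 9) * ∫ r in Ioi (0 : ℝ), (kerWeight r)⁻¹ * f r ^ 2 * r ≤
      (∫ r in Ioi (0 : ℝ), (kerWeight r)⁻¹ * f r ^ 2 * r) -
        ∫ r in Ioi (0 : ℝ), ((1 / 2 : ℝ) * ∫ s in Ioi (0 : ℝ), min (r / s) (s / r) * f s * s) * f r * r := by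
  set E : ℝ → ℝ := fun r => Real.exp (-(r ^ 2 / 4)) with hE
  set aS : ℝ → ℝ := fun s => s * E s with haS
  set As : ℝ → ℝ := fun r => 8 - 2 * (r ^ 2 + 4) * E r with hAs
  have haSc : Continuous aS := by simp only [haS, hE]; fun_prop
  have hba : ∀ r : ℝ, 0 ≤ r → |aS r| ≤ 1 * (1 + r) ^ 1 * Real.exp (-(r ^ 2 / 4)) := am1_gc_aStar
  -- the decomposition `f = g + β a⋆`, `β = α/2`, `α = ½⟨a⋆, f⟩`
  set α : ℝ := (1 / 2) * ∫ s in Ioi (0 : ℝ), (kerWeight s)⁻¹ * (aS s * f s) * s with hα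
  set β : ℝ := α / 2 with hβ
  set g : ℝ → ℝ := fun s => f s - β * aS s with hg
  have hgc : Continuous g := by simp only [hg]; fun_prop
  have hbg : ∀ r, 0 ≤ r → |g r| ≤ (|(1 : ℝ)| * |C| + |(-β)| * |(1 : ℝ)|) * (1 + r) ^ (max N 1) *
      Real.exp (-(r ^ 2 / 4)) := by
    intro r hr
    have h := am1_gc_lin hb hba 1 (-β) r hr
    have e : g r = 1 * f r + -β * aS r := by simp only [hg]; ring
    rw [e]; exact h
  -- weighted integrability
  have Iaf := am1_integrableOn_weight_mul_mul haSc hf hba hb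
  have Iaa := am1_integrableOn_weight_mul_mul haSc haSc hba hba
  have Iag := am1_integrableOn_weight_mul_mul haSc hgc hba hbg
  have Igg := am1_integrableOn_weight_mul_mul hgc hgc hbg hbg
  have hQa : (∫ s in Ioi (0 : ℝ), (kerWeight s)⁻¹ * (aS s * aS s) * s) = 4 := am1_Q_aStar
  -- orthogonality `⟨a⋆, g⟩ = 0`
  have horth : (∫ s in Ioi (0 : ℝ), (kerWeight s)⁻¹ * (s * Real.exp (-(s ^ 2 / 4)) * g s) * s) = 0 := by
    have e : (fun s : ℝ => (kerWeight s)⁻¹ * (s * Real.exp (-(s ^ 2 / 4)) * g s) * s) = fun s : ℝ =>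
        (kerWeight s)⁻¹ * (aS s * f s) * s - β * ((kerWeight s)⁻¹ * (aS s * aS s) * s) := by
      funext s; simp only [hg, haS, hE]; ring
    have Iaa' : IntegrableOn (fun s : ℝ => β * ((kerWeight s)⁻¹ * (aS s * aS s) * s)) (Ioi 0) := Iaa.const_mul β
    rw [e, integral_sub Iaf Iaa', MeasureTheory.integral_const_mul, hQa, hβ, hα]
    ring
  set Qg : ℝ := ∫ s in Ioi (0 : ℝ), (kerWeight s)⁻¹ * (g s * g s) * s with hQg
  have hQg0 : 0 ≤ Qg := setIntegral_nonneg measurableSet_Ioi fun s hs =>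
    mul_nonneg (mul_nonneg (inv_nonneg.2 (kerWeight_pos s).le) (mul_self_nonneg _)) (le_of_lt hs)
  -- `Q(f) = Q(g) + α²`
  have hQf : (∫ r in Ioi (0 : ℝ), (kerWeight r)⁻¹ * f r ^ 2 * r) = Qg + α ^ 2 := by
    have e : (fun r : ℝ => (kerWeight r)⁻¹ * f r ^ 2 * r) = fun r : ℝ =>
        (kerWeight r)⁻¹ * (g r * g r) * r + 2 * β * ((kerWeight r)⁻¹ * (aS r * g r) * r) +
          β ^ 2 * ((kerWeight r)⁻¹ * (aS r * aS r) * r) := by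
      funext r; simp only [hg]; ring
    have J2 : IntegrableOn (fun r : ℝ => 2 * β * ((kerWeight r)⁻¹ * (aS r * g r) * r)) (Ioi 0) := Iag.const_mul _
    have J3 : IntegrableOn (fun r : ℝ => β ^ 2 * ((kerWeight r)⁻¹ * (aS r * aS r) * r)) (Ioi 0) :=
      Iaa.const_mul _
    have J12 : IntegrableOn (fun r : ℝ => (kerWeight r)⁻¹ * (g r * g r) * r +
        2 * β * ((kerWeight r)⁻¹ * (aS r * g r) * r)) (Ioi 0) := Igg.add J2
    have horth' : (∫ r in Ioi (0 : ℝ), (kerWeight r)⁻¹ * (aS r * g r) * r) = 0 := horth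
    rw [e, integral_add J12 J3, integral_add Igg J2, MeasureTheory.integral_const_mul,
      MeasureTheory.integral_const_mul, horth', hQa, hβ]
    ring
  -- `P(f) = P(g) + α²`
  have hPf : (∫ r in Ioi (0 : ℝ), ((1 / 2 : ℝ) * ∫ s in Ioi (0 : ℝ), min (r / s) (s / r) * f s * s) * f r * r) =
      (1 / 2) * (∫ r in Ioi (0 : ℝ), ((∫ s in (0 : ℝ)..r, s ^ 2 * g s) ^ 2 / r ^ 3 +
        r * (∫ s in Ioi r, g s) ^ 2)) + α ^ 2 := by
    rw [am1_energy_identity hf hb]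
    have hgi : IntegrableOn g (Ioi 0) :=
      (am1_integrableOn_pow_mul hgc hbg 0).congr_fun (fun r _ => by simp) measurableSet_Ioi
    have hai : IntegrableOn aS (Ioi 0) :=
      (am1_integrableOn_pow_mul haSc hba 0).congr_fun (fun r _ => by simp) measurableSet_Ioi
    -- the functionals of `f` against those of `g` and `a⋆`
    have hAf : ∀ r : ℝ, (∫ s in (0 : ℝ)..r, s ^ 2 * f s) = (∫ s in (0 : ℝ)..r, s ^ 2 * g s) + β * As r := by
      intro r
      have hAsr : As r = 8 - 2 * (r ^ 2 + 4) * Real.exp (-(r ^ 2 / 4)) := by simp only [hAs, hE]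
      have i1 : IntervalIntegrable (fun s : ℝ => s ^ 2 * g s) volume 0 r :=
        ((continuous_pow 2).mul hgc).intervalIntegrable _ _
      have i2 : IntervalIntegrable (fun s : ℝ => β * (s ^ 2 * (s * Real.exp (-(s ^ 2 / 4))))) volume 0 r :=
        (Continuous.intervalIntegrable (by fun_prop) _ _)
      rw [hAsr, ← am1_integral_sq_mul_aStar r, ← intervalIntegral.integral_const_mul,
        ← intervalIntegral.integral_add i1 i2]
      refine intervalIntegral.integral_congr fun s _ => ?_
      simp only [hg, haS, hE]; ring
    have hBf : ∀ r : ℝ, 0 ≤ r → (∫ s in Ioi r, f s) = (∫ s in Ioi r, g s) + β * (2 * E r) := by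
      intro r hr
      rw [← am1_integral_Ioi_aStar hr, ← MeasureTheory.integral_const_mul,
        ← integral_add (hgi.mono_set (Ioi_subset_Ioi hr)) ((hai.mono_set (Ioi_subset_Ioi hr)).const_mul β)]
      refine setIntegral_congr_fun measurableSet_Ioi fun s _ => ?_
      simp only [hg, haS, hE]; ring
    have heg : IntegrableOn (fun r : ℝ => (∫ s in (0 : ℝ)..r, s ^ 2 * g s) ^ 2 / r ^ 3 +
        r * (∫ s in Ioi r, g s) ^ 2) (Ioi 0) :=
      (am1_integrableOn_A_sq_div hgc hbg).add (am1_integrableOn_mul_B_sq hgc hbg)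
    obtain ⟨hxi, hxv⟩ := am1_cross_identity hgc hbg
    obtain ⟨hSi, hSv⟩ := am1_energy_aStar
    have hpt : EqOn (fun r : ℝ => (∫ s in (0 : ℝ)..r, s ^ 2 * f s) ^ 2 / r ^ 3 + r * (∫ s in Ioi r, f s) ^ 2)
        (fun r : ℝ => ((∫ s in (0 : ℝ)..r, s ^ 2 * g s) ^ 2 / r ^ 3 + r * (∫ s in Ioi r, g s) ^ 2) +
          2 * β * ((∫ s in (0 : ℝ)..r, s ^ 2 * g s) * (8 - 2 * (r ^ 2 + 4) * Real.exp (-(r ^ 2 / 4))) / r ^ 3 +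
            r * ((∫ s in Ioi r, g s) * (2 * Real.exp (-(r ^ 2 / 4))))) +
          β ^ 2 * ((8 - 2 * (r ^ 2 + 4) * Real.exp (-(r ^ 2 / 4))) ^ 2 / r ^ 3 +
            r * (2 * Real.exp (-(r ^ 2 / 4))) ^ 2)) (Ioi 0) := by
      intro r hr
      simp only
      rw [hAf r, hBf r (le_of_lt hr)]
      simp only [hAs, hE]
      ring
    have J2 : IntegrableOn (fun r : ℝ => 2 * β * ((∫ s in (0 : ℝ)..r, s ^ 2 * g s) *
        (8 - 2 * (r ^ 2 + 4) * Real.exp (-(r ^ 2 / 4))) / r ^ 3 +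
        r * ((∫ s in Ioi r, g s) * (2 * Real.exp (-(r ^ 2 / 4)))))) (Ioi 0) := hxi.const_mul (2 * β)
    have J3 : IntegrableOn (fun r : ℝ => β ^ 2 * ((8 - 2 * (r ^ 2 + 4) * Real.exp (-(r ^ 2 / 4))) ^ 2 / r ^ 3 +
        r * (2 * Real.exp (-(r ^ 2 / 4))) ^ 2)) (Ioi 0) := hSi.const_mul (β ^ 2)
    have J12 : IntegrableOn (fun r : ℝ => ((∫ s in (0 : ℝ)..r, s ^ 2 * g s) ^ 2 / r ^ 3 +
        r * (∫ s in Ioi r, g s) ^ 2) + 2 * β * ((∫ s in (0 : ℝ)..r, s ^ 2 * g s) *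
        (8 - 2 * (r ^ 2 + 4) * Real.exp (-(r ^ 2 / 4))) / r ^ 3 +
        r * ((∫ s in Ioi r, g s) * (2 * Real.exp (-(r ^ 2 / 4)))))) (Ioi 0) := heg.add J2
    have hx0 : (∫ r in Ioi (0 : ℝ), ((∫ s in (0 : ℝ)..r, s ^ 2 * g s) * (8 - 2 * (r ^ 2 + 4) * Real.exp (-(r ^ 2 / 4))) / r ^ 3 +
        r * ((∫ s in Ioi r, g s) * (2 * Real.exp (-(r ^ 2 / 4)))))) = 0 := by
      rw [← am1_weight_aStar_mul g, horth] at hxv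
      linarith
    have hS8 : (∫ r in Ioi (0 : ℝ), ((8 - 2 * (r ^ 2 + 4) * Real.exp (-(r ^ 2 / 4))) ^ 2 / r ^ 3 +
        r * (2 * Real.exp (-(r ^ 2 / 4))) ^ 2)) = 8 := by linarith
    rw [setIntegral_congr_fun measurableSet_Ioi hpt, integral_add J12 J3, integral_add heg J2,
      MeasureTheory.integral_const_mul, MeasureTheory.integral_const_mul, hx0, hS8, hβ]
    ring
  -- the constraint: `∫ r² g = −4α`
  have hmg : (∫ r in Ioi (0 : ℝ), r ^ 2 * g r) = -4 * α := by
    obtain ⟨h8v, h8i⟩ := am1_integral_Ioi_pow_three_mul_exp (c := 4) (by norm_num)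
    have I2f := am1_integrableOn_pow_mul hf hb 2
    have I3 : IntegrableOn (fun r : ℝ => β * (r ^ 3 * Real.exp (-(r ^ 2 / 4)))) (Ioi 0) := h8i.const_mul β
    have e : (fun r : ℝ => r ^ 2 * g r) = fun r : ℝ => r ^ 2 * f r - β * (r ^ 3 * Real.exp (-(r ^ 2 / 4))) := by
      funext r; simp only [hg, haS, hE]; ring
    rw [e, integral_sub I2f I3, MeasureTheory.integral_const_mul, hm, h8v, hβ]
    ring
  -- Cauchy–Schwarz through the discriminant: `(∫ r² g)² ≤ (∫ r³Φ) Q(g) ≤ 32 Q(g)`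
  obtain ⟨h32, hI3i⟩ := am1_integral_pow_three_mul_kerWeight_le
  have hI30 : 0 ≤ ∫ r in Ioi (0 : ℝ), r ^ 3 * kerWeight r :=
    setIntegral_nonneg measurableSet_Ioi fun r hr => mul_nonneg (pow_nonneg (le_of_lt hr) 3) (kerWeight_pos r).le
  have hdisc : ∀ y : ℝ, 2 * y * (∫ r in Ioi (0 : ℝ), r ^ 2 * g r) - y ^ 2 * (∫ r in Ioi (0 : ℝ), r ^ 3 * kerWeight r) ≤ Qg := by
    intro y
    have I2g := am1_integrableOn_pow_mul hgc hbg 2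
    have h0 : 0 ≤ ∫ r in Ioi (0 : ℝ), (kerWeight r)⁻¹ * ((y * (kerWeight r * r) - g r) *
        (y * (kerWeight r * r) - g r)) * r :=
      setIntegral_nonneg measurableSet_Ioi fun r hr => mul_nonneg (mul_nonneg
        (inv_nonneg.2 (kerWeight_pos r).le) (mul_self_nonneg _)) (le_of_lt hr)
    have e : (fun r : ℝ => (kerWeight r)⁻¹ * ((y * (kerWeight r * r) - g r) * (y * (kerWeight r * r) - g r)) * r) =
        fun r : ℝ => y ^ 2 * (r ^ 3 * kerWeight r) - 2 * y * (r ^ 2 * g r) + (kerWeight r)⁻¹ * (g r * g r) * r := by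
      funext r
      have hΦ : kerWeight r ≠ 0 := (kerWeight_pos r).ne'
      field_simp
      ring
    have J1 : IntegrableOn (fun r : ℝ => y ^ 2 * (r ^ 3 * kerWeight r)) (Ioi 0) := hI3i.const_mul _
    have J2 : IntegrableOn (fun r : ℝ => 2 * y * (r ^ 2 * g r)) (Ioi 0) := I2g.const_mul _
    have J12 : IntegrableOn (fun r : ℝ => y ^ 2 * (r ^ 3 * kerWeight r) - 2 * y * (r ^ 2 * g r)) (Ioi 0) := J1.sub J2
    rw [e, integral_add J12 Igg, integral_sub J1 J2, MeasureTheory.integral_const_mul,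
      MeasureTheory.integral_const_mul] at h0
    linarith
  have hCS := am1_sq_le_of_forall hI30 hdisc
  have hα2 : α ^ 2 ≤ 2 * Qg := by
    rw [hmg] at hCS
    nlinarith [hCS, h32, hQg0]
  -- deflation and conclusion
  have hdef := am1_deflation hgc hbg horth
  rw [hQf, hPf]
  nlinarith [hdef, hα2, hQg0]

/-- **Registered stub `stub_arnoldModeOne1D`** (line `Sketch` of crux `CoreLinearInvertibility`,
stmt-NavierStokesRegularity-17973): the one-dimensional constrained Arnold coercivity in the angular
mode `k = ±1` at the Gaussian — for the radial coefficient `a` (continuous on `[0,∞)`, Gaussian class)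
with the first-moment constraint `∫ r² a = 0`, `γ ∫ A a² r ≤ ∫ A a² r − ∫ (B₁a) a r` with
`A = Φ⁻¹ = (kerWeight)⁻¹`, `(B₁a)(r) = ½ ∫₀^∞ min(r/s, s/r) a(s) s ds`; here `γ = 1/9`
(reduction to a continuous extension `a(max(r,0))`, then `am1_coercive_continuous`).
[cite: GallaySverak2021, Thm. 2.5 proof] -/
theorem stub_arnoldModeOne1D :
    ∃ γ : ℝ, 0 < γ ∧ ∀ a : ℝ → ℝ, ContinuousOn a (Set.Ici 0) →
    (∃ (C : ℝ) (N : ℕ), ∀ r : ℝ, 0 ≤ r → |a r| ≤ C * (1 + r) ^ N * Real.exp (-(r ^ 2 / 4))) →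
    ∫ r in Set.Ioi (0 : ℝ), r ^ 2 * a r = 0 →
    γ * ∫ r in Set.Ioi (0 : ℝ), (kerWeight r)⁻¹ * a r ^ 2 * r ≤
      (∫ r in Set.Ioi (0 : ℝ), (kerWeight r)⁻¹ * a r ^ 2 * r) -
        ∫ r in Set.Ioi (0 : ℝ),
          ((1 / 2 : ℝ) * ∫ s in Set.Ioi (0 : ℝ), min (r / s) (s / r) * a s * s) * a r * r := by
  refine ⟨1 / 9, by norm_num, fun a ha hgc hm => ?_⟩
  obtain ⟨C, N, hb⟩ := hgc
  -- continuous extension `f = a ∘ max(·, 0)`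
  set f : ℝ → ℝ := fun r => a (max r 0) with hf
  have hfc : Continuous f :=
    ha.comp_continuous (continuous_id.max continuous_const) fun r => mem_Ici.2 (le_max_right _ _)
  have hfa : ∀ r : ℝ, 0 ≤ r → f r = a r := fun r hr => by simp only [hf, max_eq_left hr]
  have hbf : ∀ r : ℝ, 0 ≤ r → |f r| ≤ C * (1 + r) ^ N * Real.exp (-(r ^ 2 / 4)) := fun r hr => by
    rw [hfa r hr]; exact hb r hr
  have hQ : (∫ r in Ioi (0 : ℝ), (kerWeight r)⁻¹ * a r ^ 2 * r) = ∫ r in Ioi (0 : ℝ), (kerWeight r)⁻¹ * f r ^ 2 * r :=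
    setIntegral_congr_fun measurableSet_Ioi fun r hr => by rw [hfa r (le_of_lt hr)]
  have hin : ∀ r : ℝ, (∫ s in Ioi (0 : ℝ), min (r / s) (s / r) * a s * s) =
      ∫ s in Ioi (0 : ℝ), min (r / s) (s / r) * f s * s := fun r =>
    setIntegral_congr_fun measurableSet_Ioi fun s hs => by rw [hfa s (le_of_lt hs)]
  have hP : (∫ r in Ioi (0 : ℝ), ((1 / 2 : ℝ) * ∫ s in Ioi (0 : ℝ), min (r / s) (s / r) * a s * s) * a r * r) =
      ∫ r in Ioi (0 : ℝ), ((1 / 2 : ℝ) * ∫ s in Ioi (0 : ℝ), min (r / s) (s / r) * f s * s) * f r * r :=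
    setIntegral_congr_fun measurableSet_Ioi fun r hr => by rw [hin r, hfa r (le_of_lt hr)]
  have hmf : (∫ r in Ioi (0 : ℝ), r ^ 2 * f r) = 0 := by
    calc (∫ r in Ioi (0 : ℝ), r ^ 2 * f r) = ∫ r in Ioi (0 : ℝ), r ^ 2 * a r :=
          setIntegral_congr_fun measurableSet_Ioi fun r hr => by rw [hfa r (le_of_lt hr)]
      _ = 0 := hm
  rw [hQ, hP]
  exact am1_coercive_continuous hfc hbf hmf

end Summit.NavierStokesRegularity.NavierStokesRegularity.Theorems
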